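import Literature.AnabelianGeometry.Anabelioids.FiniteEtaleComposition
import Literature.AnabelianGeometry.SemiGraphs.AmbientArrowClasses

/-!
# Locally trivial ⇒ locally finite étale; composites of locally finite étale arrows ([SemiAnbd] Def 2.2 (ii)) — merge step M5, part 2

Mochizuki, *Semi-graphs of anabelioids*, Publ. RIMS **42** (2006), §2 Def 2.2 (ii) p.24 (locally
trivial / locally finite étale morphisms) (kurims `paper:url-f33ace170ff4`); [GeoAn] Def 1.2.2 (i)
p.17 (finite étale morphisms of anabelioids). [cite: MochizukiSemiAnbd2006, Def 2.2 (ii), p. 24]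

PROOF-ONLY: the two formal laws of the §§4–5 container `SemiAnbdVocab` (`InterfaceVocab.lean`) about
classes of arrows that need [GeoAn] Def 1.2.2 bookkeeping (`Anabelioids/FiniteEtaleComposition.lean`):

* `Hom.IsLocallyTrivial.isLocallyFiniteEtale` — an isomorphism of anabelioids is finite étale, so a
  locally trivial 1-morphism is locally finite étale (container law
  `isLocallyFiniteEtale_of_isLocallyTrivial`);
* `HomOver.IsLocallyFiniteEtale.comp` / `Hom.IsLocallyFiniteEtale.comp` — composites of locally finite
  étale 1-morphisms are locally finite étale (constituents compose, `IsFiniteEtale.comp`; container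
  law `isLocallyFiniteEtale_comp`);

and the same on arrows of the Rmk 2.4.2 category `SgAQuot` (`locallyFiniteEtale_of_locallyTrivial`,
`comp_mem_locallyFiniteEtale`, `id_mem_locallyFiniteEtale`).  No definition is introduced.
-/

namespace Literature.AnabelianGeometry.SemiGraphs

open CategoryTheory Literature.AnabelianGeometry.Anabelioids

universe v₁ u₁ u

namespace SemiGraphOfAnabelioids

variable {𝒢 ℋ 𝒦 : SemiGraphOfAnabelioids.{v₁, u₁, u}}

/-- **Locally trivial 1-morphisms are locally finite étale** (an isomorphism of anabelioids is finite
étale, [GeoAn] Def 1.2.2). [cite: MochizukiSemiAnbd2006, Def 2.2 (ii), p. 24] -/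
theorem Hom.IsLocallyTrivial.isLocallyFiniteEtale {φ : Hom 𝒢 ℋ} (h : φ.IsLocallyTrivial) :
    φ.IsLocallyFiniteEtale :=
  ⟨fun v => @isFiniteEtale_of_isEquivalence _ _ _ _ _ _ (φ.φV v).pullback (h.1 v),
    fun e => @isFiniteEtale_of_isEquivalence _ _ _ _ _ _ (φ.φE e (φ.base.edgeMap e) rfl).pullback
      (h.2 e)⟩

variable {f : 𝒢.graph ⟶ ℋ.graph} {g : ℋ.graph ⟶ 𝒦.graph}

/-- **Composites of locally finite étale 1-morphisms (over composable bases) are locally finite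
étale**: the constituents of the composite are the composites of the constituents (through the
canonical intermediate edge, `HomOver.compE`), and finite étale morphisms of anabelioids compose.
[cite: MochizukiSemiAnbd2006, Def 2.2 (ii), p. 24] -/
theorem HomOver.IsLocallyFiniteEtale.comp {φ : HomOver 𝒢 ℋ f} {ψ : HomOver ℋ 𝒦 g}
    (hφ : φ.toHom.IsLocallyFiniteEtale) (hψ : ψ.toHom.IsLocallyFiniteEtale) :
    (φ.comp ψ).toHom.IsLocallyFiniteEtale :=
  ⟨fun v => (hψ.1 (f.vertexMap v)).comp (hφ.1 v),
    fun e => (hψ.2 (f.edgeMap e)).comp (hφ.2 e)⟩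

/-- **Composites of locally finite étale 1-morphisms are locally finite étale.**
[cite: MochizukiSemiAnbd2006, Def 2.2 (ii), p. 24] -/
theorem Hom.IsLocallyFiniteEtale.comp {φ : Hom 𝒢 ℋ} {ψ : Hom ℋ 𝒦} (hφ : φ.IsLocallyFiniteEtale)
    (hψ : ψ.IsLocallyFiniteEtale) : (φ.comp ψ).IsLocallyFiniteEtale :=
  HomOver.IsLocallyFiniteEtale.comp (φ := φ.over) (ψ := ψ.over) hφ hψ

/-- Composites of locally trivial 1-morphisms are locally trivial (equivalences compose).
[cite: MochizukiSemiAnbd2006, Def 2.2 (ii), p. 24] -/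
theorem HomOver.IsLocallyTrivial.comp {φ : HomOver 𝒢 ℋ f} {ψ : HomOver ℋ 𝒦 g}
    (hφ : φ.toHom.IsLocallyTrivial) (hψ : ψ.toHom.IsLocallyTrivial) :
    (φ.comp ψ).toHom.IsLocallyTrivial := by
  refine ⟨fun v => ?_, fun e => ?_⟩
  · haveI : (φ.φV v).pullback.IsEquivalence := hφ.1 v
    haveI : (ψ.φV (f.vertexMap v)).pullback.IsEquivalence := hψ.1 (f.vertexMap v)
    change ((ψ.φV (f.vertexMap v)).pullback ⋙ (φ.φV v).pullback).IsEquivalence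
    infer_instance
  · haveI : (φ.φE e (f.edgeMap e) rfl).pullback.IsEquivalence := hφ.2 e
    haveI : (ψ.φE (f.edgeMap e) (g.edgeMap (f.edgeMap e)) rfl).pullback.IsEquivalence :=
      hψ.2 (f.edgeMap e)
    change ((ψ.φE (f.edgeMap e) (g.edgeMap (f.edgeMap e)) rfl).pullback ⋙
      (φ.φE e (f.edgeMap e) rfl).pullback).IsEquivalence
    infer_instance

end SemiGraphOfAnabelioids

/-! ### On arrows of the 1-category -/

namespace SgAQuot

open SemiGraphOfAnabelioids

variable {X Y Z : SgAQuot.{v₁, u₁, u}}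

/-- **Law `isLocallyFiniteEtale_of_isLocallyTrivial`** on arrows of the Rmk 2.4.2 category.
[cite: MochizukiSemiAnbd2006, Def 2.2 (ii), p. 24] -/
theorem locallyFiniteEtale_of_locallyTrivial {a : X ⟶ Y} (h : locallyTrivial a) :
    locallyFiniteEtale a := by
  obtain ⟨f, c⟩ := a
  induction c using Quotient.ind with
  | _ φ => exact Hom.IsLocallyTrivial.isLocallyFiniteEtale (φ := φ.toHom) h

/-- Identities are locally finite étale. [cite: MochizukiSemiAnbd2006, Def 2.2 (ii), p. 24] -/
theorem id_mem_locallyFiniteEtale (X : SgAQuot.{v₁, u₁, u}) : locallyFiniteEtale (𝟙 X) :=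
  locallyFiniteEtale_of_locallyTrivial (id_mem_locallyTrivial X)

/-- **Law `isLocallyFiniteEtale_comp`** on arrows of the Rmk 2.4.2 category: composites of locally
finite étale arrows are locally finite étale. [cite: MochizukiSemiAnbd2006, Def 2.2 (ii), p. 24] -/
theorem comp_mem_locallyFiniteEtale {a : X ⟶ Y} {b : Y ⟶ Z} (ha : locallyFiniteEtale a)
    (hb : locallyFiniteEtale b) : locallyFiniteEtale (a ≫ b) := by
  obtain ⟨f, c⟩ := a
  obtain ⟨g, d⟩ := b
  induction c using Quotient.ind with
  | _ φ =>
    induction d using Quotient.ind with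
    | _ ψ => exact HomOver.IsLocallyFiniteEtale.comp ha hb

/-- Composites of locally trivial arrows are locally trivial. [cite: MochizukiSemiAnbd2006, Def 2.2 (ii), p. 24] -/
theorem comp_mem_locallyTrivial {a : X ⟶ Y} {b : Y ⟶ Z} (ha : locallyTrivial a)
    (hb : locallyTrivial b) : locallyTrivial (a ≫ b) := by
  obtain ⟨f, c⟩ := a
  obtain ⟨g, d⟩ := b
  induction c using Quotient.ind with
  | _ φ =>
    induction d using Quotient.ind with
    | _ ψ => exact HomOver.IsLocallyTrivial.comp ha hb

/-- `X[v] → X` is locally finite étale. [cite: MochizukiSemiAnbd2006, Def 4.1, p. 50] -/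
theorem homOf_atVertexHom_mem_locallyFiniteEtale (𝒢 : SemiGraphOfAnabelioids.{v₁, u₁, u})
    (v : 𝒢.graph.Vertex) : locallyFiniteEtale (homOf (𝒢.atVertexHom v)) :=
  locallyFiniteEtale_of_locallyTrivial (homOf_atVertexHom_mem_locallyTrivial 𝒢 v)

/-- `X[e] → X` is locally finite étale. [cite: MochizukiSemiAnbd2006, Def 4.1, p. 50] -/
theorem homOf_atEdgeHom_mem_locallyFiniteEtale (𝒢 : SemiGraphOfAnabelioids.{v₁, u₁, u})
    (e : 𝒢.graph.Edge) : locallyFiniteEtale (homOf (𝒢.atEdgeHom e)) :=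
  locallyFiniteEtale_of_locallyTrivial (homOf_atEdgeHom_mem_locallyTrivial 𝒢 e)

end SgAQuot

end Literature.AnabelianGeometry.SemiGraphs
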